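import Literature.AnabelianGeometry.SemiGraphs.TemperedDecompositionEmbedding
import Literature.AnabelianGeometry.SemiGraphs.TemperedThm37OfNoCore
import Literature.AnabelianGeometry.SemiGraphs.TemperedSubgraphThm37Hypotheses
import Literature.AnabelianGeometry.SemiGraphs.TemperedConj2OfLocallyFinite
import HarnessLib

/-!
# [IUTchI] Prop. 2.2, third inclusion, for INFINITE sub-semi-graphs `ℍ` whose `𝒢_ℍ` has no
# infinitely-branching core — row «DECOMP-CT@NO-CORE-ℍ» ([IUTchI] §2 pp. 44–45; [SemiAnbd] Thm. 3.7 (iii))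

Mochizuki, *Inter-universal Teichmüller theory I: construction of Hodge theaters*, kurims manuscript
(May 2020), §2, Proposition 2.2 p. 45 ("`Π^tp_ℍ ⊆ Π^tp_𝔾` … is commensurably terminal"), for a connected
sub-semi-graph `ℍ ⊆ 𝔾` (p. 44 l. 27–45: "decomposition subgroup … associated to the sub-semi-graph `ℍ`")
[cite: Mochizuki2012, IUTchI Prop 2.2 p.45] [claim: Mochizuki2012, status: disputed] (nothing of the
series is asserted; PROVED are the displayed statements about the tree's own objects); Mochizuki,
*Semi-graphs of anabelioids*, Publ. RIMS **42** (2006), §3, Theorem 3.7 (iii) pp. 40–41 ("any compact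
subgroup … is contained in at least one verticial subgroup … precisely two …")
[cite: MochizukiSemiAnbd2006, Thm 3.7(iii) pp.40-41].

PROOF-ONLY (abc-iut cell, layer L3, row «DECOMP-CT@NO-CORE-ℍ», L3-lead ruling γ52 (4); seat
abc-iut-w4-d064 gen 7).  State of the tree: abc-iut-w4-d052 / abc-iut-L3-d1's assembly
`decompSubgroupsCommensurablyTerminal` (`TemperedDecompositionEmbedding.lean`) proves the third inclusion of
[IUTchI] Prop. 2.2 for a GENERAL sub-semi-graph `ℍ` from the [SemiAnbd] Thm. 3.7 hypothesis bundles of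
`𝒢` and `𝒢_ℍ` and ONE further binder, Thm. 3.7 (iii) AT `𝒢_ℍ` (`CompactInVerticialAt (𝒢.restrict H)`),
which the tree discharges only for FINITE `ℍ` (`decompSubgroupsCommensurablyTerminal_of_finite`, via
`compactInVerticialFin_holds`).  abc-iut-f-176's `TemperedThm37OfNoCore.lean` shows that at every
countable graph WITHOUT AN INFINITELY-BRANCHING CORE the named fact `CompactInVerticialAt` is EQUIVALENT to
its existence sentence («every compact subgroup lies in SOME verticial subgroup»,
`compactInVerticialAt_iff_exists_verticial_of_noCore`) — the uniqueness/edge conjunct being a theorem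
there (`compactInTwoVerticial_of_noCore`).  Composing the two BY NAME:

* **`decompSubgroupsCommensurablyTerminal_of_noCore`** — [IUTchI] Prop. 2.2, third inclusion, for every
  (possibly INFINITE) `ℍ` such that `𝔾_ℍ` has no core: binders = `Thm37Hypotheses` of `𝒢` and of `𝒢_ℍ`,
  the no-core clause `hNC` on `𝔾_ℍ` LITERALLY as `TemperedThm37OfNoCore.lean` spells it, and the
  EXISTENCE SENTENCE `hex` of Thm. 3.7 (iii) at `𝒢_ℍ` (every chart) — `TemperedThm37OfNoCore`'s
  conclusion is only the «iff ∃ verticial» form, so the ∃-sentence stays an explicit hypothesis here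
  (honest: as a bare ∀-closure over countable graphs it FAILS, e.g. at the countermodel `𝒢_θ` of record;
  it is a theorem for finite graphs, `compactInVerticialFin_holds`);
* `commensurator_eq_of_mem_decompSubgroups_of_noCore` (`C(D) = D`) and the normaliser form
  `normalizer_eq_of_mem_decompSubgroups_of_noCore` (`N(D) = D`, [AbsAnab] Rem. 0.1.2);
* the RANK and LOCALLY-FINITE specialisations `…_of_rank`, `…_of_locallyFinite` (the no-core clause
  discharged by abc-iut-f-176's `SemiGraph.noCore_of_rank`; locally finite = constant rank), still
  carrying `hex`.

Closedness of decomposition subgroups needs neither binder and is already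
`isClosed_of_mem_decompSubgroups` (`TemperedDecompositionEmbedding.lean`); it is cited, not re-declared.
Theorems only: no `def`, no instance, no new `Prop` fact; typed ≠ proved elsewhere; nothing here bears on
[IUTchIII] Cor. 3.12 or asserts that abc is proved or refuted.
-/

namespace Literature.AnabelianGeometry.SemiGraphs

namespace ProfiniteSemiGraph

namespace TemperedPiChart

open CategoryTheory Topology
open Literature.AnabelianGeometry.AbsoluteAnabelian (IsCommensurablyTerminal)

universe u

variable {𝒢 : ProfiniteSemiGraph.{u}} {c : TemperedPiChart 𝒢} {H : 𝒢.graph.Subgraph}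

/-! ### Thm. 3.7 (iii) at `𝒢_ℍ` without core, from the existence sentence -/

/-- At a sub-semi-graph `ℍ` whose `𝔾_ℍ` has no infinitely-branching core, Thm. 3.7 (iii) AT `𝒢_ℍ`
(`CompactInVerticialAt (𝒢.restrict H)`) follows from its EXISTENCE SENTENCE alone (abc-iut-f-176's
`compactInVerticialAt_iff_exists_verticial_of_noCore`, read at `𝒢_ℍ`).
[cite: MochizukiSemiAnbd2006, Thm 3.7(iii) pp.40-41] -/
theorem compactInVerticialAt_restrict_of_noCore
    (hNC : ∀ S : Set (𝒢.restrict H).graph.Vertex, S.Nonempty → ∃ w ∈ S,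
      {b : (𝒢.restrict H).graph.Branch | (𝒢.restrict H).graph.abuts b = some w ∧
        ∃ b', b' ≠ b ∧ (𝒢.restrict H).graph.edgeOf b' = (𝒢.restrict H).graph.edgeOf b ∧
          ∃ w' ∈ S, (𝒢.restrict H).graph.abuts b' = some w'}.Finite)
    (hex : ∀ (c' : TemperedPiChart (𝒢.restrict H)) (C : Subgroup c'.G), IsCompact (C : Set c'.G) →
      ∃ (v : (𝒢.restrict H).graph.Vertex) (K : Subgroup c'.G), K ∈ verticialSubgroups c' v ∧ C ≤ K) :
    CompactInVerticialAt (𝒢.restrict H) :=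
  ((𝒢.restrict H).compactInVerticialAt_iff_exists_verticial_of_noCore hNC).mpr fun _ => hex

/-! ### [IUTchI] Prop. 2.2, third inclusion, at INFINITE `ℍ` without core -/

/-- **[IUTchI] Prop. 2.2, third inclusion, for a (possibly infinite) sub-semi-graph `ℍ` whose `𝔾_ℍ`
has no infinitely-branching core**: every decomposition subgroup `Π^tp_ℍ ∈ decompSubgroups c ℍ` is
commensurably terminal in `π₁^temp(𝒢)` — from the [SemiAnbd] Thm. 3.7 hypothesis bundles of `𝒢` and
`𝒢_ℍ`, the no-core clause on `𝔾_ℍ`, and the existence sentence of Thm. 3.7 (iii) at `𝒢_ℍ` (explicit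
binder `hex`; the uniqueness/edge conjunct is abc-iut-f-176's theorem at no-core graphs).  Assembly
`decompSubgroupsCommensurablyTerminal` (abc-iut-w4-d052 / abc-iut-L3-d1) BY NAME.
[cite: Mochizuki2012, IUTchI Prop 2.2 p.45] -/
theorem decompSubgroupsCommensurablyTerminal_of_noCore (h37 : 𝒢.Thm37Hypotheses)
    (h37H : (𝒢.restrict H).Thm37Hypotheses)
    (hNC : ∀ S : Set (𝒢.restrict H).graph.Vertex, S.Nonempty → ∃ w ∈ S,
      {b : (𝒢.restrict H).graph.Branch | (𝒢.restrict H).graph.abuts b = some w ∧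
        ∃ b', b' ≠ b ∧ (𝒢.restrict H).graph.edgeOf b' = (𝒢.restrict H).graph.edgeOf b ∧
          ∃ w' ∈ S, (𝒢.restrict H).graph.abuts b' = some w'}.Finite)
    (hex : ∀ (c' : TemperedPiChart (𝒢.restrict H)) (C : Subgroup c'.G), IsCompact (C : Set c'.G) →
      ∃ (v : (𝒢.restrict H).graph.Vertex) (K : Subgroup c'.G), K ∈ verticialSubgroups c' v ∧ C ≤ K) :
    c.DecompSubgroupsCommensurablyTerminal H :=
  decompSubgroupsCommensurablyTerminal h37 h37H (compactInVerticialAt_restrict_of_noCore hNC hex)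

/-- The commensurator form at no-core `ℍ`: `C_{π₁^temp(𝒢)}(D) = D` for every `D ∈ decompSubgroups c ℍ`.
[cite: Mochizuki2012, IUTchI Prop 2.2 p.45] -/
theorem commensurator_eq_of_mem_decompSubgroups_of_noCore (h37 : 𝒢.Thm37Hypotheses)
    (h37H : (𝒢.restrict H).Thm37Hypotheses)
    (hNC : ∀ S : Set (𝒢.restrict H).graph.Vertex, S.Nonempty → ∃ w ∈ S,
      {b : (𝒢.restrict H).graph.Branch | (𝒢.restrict H).graph.abuts b = some w ∧
        ∃ b', b' ≠ b ∧ (𝒢.restrict H).graph.edgeOf b' = (𝒢.restrict H).graph.edgeOf b ∧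
          ∃ w' ∈ S, (𝒢.restrict H).graph.abuts b' = some w'}.Finite)
    (hex : ∀ (c' : TemperedPiChart (𝒢.restrict H)) (C : Subgroup c'.G), IsCompact (C : Set c'.G) →
      ∃ (v : (𝒢.restrict H).graph.Vertex) (K : Subgroup c'.G), K ∈ verticialSubgroups c' v ∧ C ≤ K)
    {D : Subgroup c.G} (hD : D ∈ c.decompSubgroups H) :
    Subgroup.Commensurable.commensurator D = D :=
  (decompSubgroupsCommensurablyTerminal_of_noCore h37 h37H hNC hex D hD).commensurator_eq

/-- The normaliser form at no-core `ℍ`: `N_{π₁^temp(𝒢)}(D) = D` for every `D ∈ decompSubgroups c ℍ`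
(commensurably terminal ⇒ normally terminal, [AbsAnab] Rem. 0.1.2).
[cite: Mochizuki2012, IUTchI Prop 2.2 p.45] -/
theorem normalizer_eq_of_mem_decompSubgroups_of_noCore (h37 : 𝒢.Thm37Hypotheses)
    (h37H : (𝒢.restrict H).Thm37Hypotheses)
    (hNC : ∀ S : Set (𝒢.restrict H).graph.Vertex, S.Nonempty → ∃ w ∈ S,
      {b : (𝒢.restrict H).graph.Branch | (𝒢.restrict H).graph.abuts b = some w ∧
        ∃ b', b' ≠ b ∧ (𝒢.restrict H).graph.edgeOf b' = (𝒢.restrict H).graph.edgeOf b ∧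
          ∃ w' ∈ S, (𝒢.restrict H).graph.abuts b' = some w'}.Finite)
    (hex : ∀ (c' : TemperedPiChart (𝒢.restrict H)) (C : Subgroup c'.G), IsCompact (C : Set c'.G) →
      ∃ (v : (𝒢.restrict H).graph.Vertex) (K : Subgroup c'.G), K ∈ verticialSubgroups c' v ∧ C ≤ K)
    {D : Subgroup c.G} (hD : D ∈ c.decompSubgroups H) :
    Subgroup.normalizer (D : Set c.G) = D :=
  (decompSubgroupsCommensurablyTerminal_of_noCore h37 h37H hNC hex D hD).isNormallyTerminal.normalizer_eq

/-! ### The rank and locally-finite specialisations (no-core clause discharged) -/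

/-- **Ranked `𝔾_ℍ`**: if the vertices of `𝔾_ℍ` carry a rank `ρ` with only finitely many branches at
each vertex toward vertices of equal or higher rank (abc-iut-f-176's `SemiGraph.noCore_of_rank`: TAME
graphs, stars of any valence, …), then — given the Thm. 3.7 bundles and the existence sentence at `𝒢_ℍ` —
every decomposition subgroup of `ℍ` is commensurably terminal in `π₁^temp(𝒢)`.
[cite: Mochizuki2012, IUTchI Prop 2.2 p.45] -/
theorem decompSubgroupsCommensurablyTerminal_of_rank (h37 : 𝒢.Thm37Hypotheses)
    (h37H : (𝒢.restrict H).Thm37Hypotheses) (ρ : (𝒢.restrict H).graph.Vertex → ℕ)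
    (hρ : ∀ w : (𝒢.restrict H).graph.Vertex,
      {b : (𝒢.restrict H).graph.Branch | (𝒢.restrict H).graph.abuts b = some w ∧
        ∃ b', b' ≠ b ∧ (𝒢.restrict H).graph.edgeOf b' = (𝒢.restrict H).graph.edgeOf b ∧
          ∃ w', (𝒢.restrict H).graph.abuts b' = some w' ∧ ρ w ≤ ρ w'}.Finite)
    (hex : ∀ (c' : TemperedPiChart (𝒢.restrict H)) (C : Subgroup c'.G), IsCompact (C : Set c'.G) →
      ∃ (v : (𝒢.restrict H).graph.Vertex) (K : Subgroup c'.G), K ∈ verticialSubgroups c' v ∧ C ≤ K) :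
    c.DecompSubgroupsCommensurablyTerminal H :=
  decompSubgroupsCommensurablyTerminal_of_noCore h37 h37H
    (SemiGraph.noCore_of_rank (𝒢.restrict H).graph ρ hρ) hex

/-- **Locally finite `𝔾_ℍ`** (finitely many branches at every vertex; `ℍ` may be infinite): given the
Thm. 3.7 bundles and the existence sentence at `𝒢_ℍ`, every decomposition subgroup of `ℍ` is
commensurably terminal in `π₁^temp(𝒢)` (constant rank `0`). [cite: Mochizuki2012, IUTchI Prop 2.2 p.45] -/
theorem decompSubgroupsCommensurablyTerminal_of_locallyFinite (h37 : 𝒢.Thm37Hypotheses)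
    (h37H : (𝒢.restrict H).Thm37Hypotheses)
    (hlf : ∀ w : (𝒢.restrict H).graph.Vertex,
      {b : (𝒢.restrict H).graph.Branch | (𝒢.restrict H).graph.abuts b = some w}.Finite)
    (hex : ∀ (c' : TemperedPiChart (𝒢.restrict H)) (C : Subgroup c'.G), IsCompact (C : Set c'.G) →
      ∃ (v : (𝒢.restrict H).graph.Vertex) (K : Subgroup c'.G), K ∈ verticialSubgroups c' v ∧ C ≤ K) :
    c.DecompSubgroupsCommensurablyTerminal H :=
  decompSubgroupsCommensurablyTerminal_of_rank h37 h37H (fun _ => 0)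
    (fun w => (hlf w).subset fun _ hb => hb.1) hex

/-- The commensurator form at locally finite `𝔾_ℍ`: `C_{π₁^temp(𝒢)}(D) = D` for every
`D ∈ decompSubgroups c ℍ`. [cite: Mochizuki2012, IUTchI Prop 2.2 p.45] -/
theorem commensurator_eq_of_mem_decompSubgroups_of_locallyFinite (h37 : 𝒢.Thm37Hypotheses)
    (h37H : (𝒢.restrict H).Thm37Hypotheses)
    (hlf : ∀ w : (𝒢.restrict H).graph.Vertex,
      {b : (𝒢.restrict H).graph.Branch | (𝒢.restrict H).graph.abuts b = some w}.Finite)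
    (hex : ∀ (c' : TemperedPiChart (𝒢.restrict H)) (C : Subgroup c'.G), IsCompact (C : Set c'.G) →
      ∃ (v : (𝒢.restrict H).graph.Vertex) (K : Subgroup c'.G), K ∈ verticialSubgroups c' v ∧ C ≤ K)
    {D : Subgroup c.G} (hD : D ∈ c.decompSubgroups H) :
    Subgroup.Commensurable.commensurator D = D :=
  (decompSubgroupsCommensurablyTerminal_of_locallyFinite h37 h37H hlf hex D hD).commensurator_eq

/-! ### v2 (append-only): the `𝒢_ℍ`-side bundle DERIVED for connected `ℍ`, and the tree's
`IsLocallyFinite` predicate — theorems drafted in parallel by abc-iut-w6-d071 gen 5 (staged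
`HOME/staging/w6/w6-d071/g5/TemperedDecompositionEmbeddingOfNoCore.lean`, L3-lead γ56 (1)), adopted here
verbatim up to names with co-author credit; inputs abc-iut-w4-d052's `Thm37Hypotheses.restrictSub` and
abc-iut-w6-d062's `compactInVerticialAt_iff_exists_verticial_of_isLocallyFinite`, BY NAME. -/

/-- **… with the `𝒢_ℍ`-side bundle DERIVED** (co-author abc-iut-w6-d071): for `ℍ` CONNECTED with a
vertex (print's standing shape of `ℍ`, [IUTchI] §2 p. 44), the binders are the Thm. 3.7 bundle of `𝒢`,
the no-core clause on `𝔾_ℍ` and the existence sentence of Thm. 3.7 (iii) at `𝒢_ℍ`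
(`Thm37Hypotheses.restrictSub`, abc-iut-w4-d052). [cite: Mochizuki2012, IUTchI Prop 2.2 p.45] -/
theorem decompSubgroupsCommensurablyTerminal_of_noCore_of_isConnected (h37 : 𝒢.Thm37Hypotheses)
    (hconn : (𝒢.restrict H).IsConnected) (hv : (𝒢.restrict H).HasVertex)
    (hNC : ∀ S : Set (𝒢.restrict H).graph.Vertex, S.Nonempty → ∃ w ∈ S,
      {b : (𝒢.restrict H).graph.Branch | (𝒢.restrict H).graph.abuts b = some w ∧
        ∃ b', b' ≠ b ∧ (𝒢.restrict H).graph.edgeOf b' = (𝒢.restrict H).graph.edgeOf b ∧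
          ∃ w' ∈ S, (𝒢.restrict H).graph.abuts b' = some w'}.Finite)
    (hex : ∀ (c' : TemperedPiChart (𝒢.restrict H)) (C : Subgroup c'.G), IsCompact (C : Set c'.G) →
      ∃ (v : (𝒢.restrict H).graph.Vertex) (K : Subgroup c'.G), K ∈ verticialSubgroups c' v ∧ C ≤ K) :
    c.DecompSubgroupsCommensurablyTerminal H :=
  decompSubgroupsCommensurablyTerminal_of_noCore h37 (h37.restrictSub H hconn hv) hNC hex

/-- **Locally finite `𝔾_ℍ`, tree predicate `SemiGraph.IsLocallyFinite`** (co-author abc-iut-w6-d071):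
given the Thm. 3.7 bundles and the existence sentence at `𝒢_ℍ`, every decomposition subgroup of `ℍ` is
commensurably terminal in `π₁^temp(𝒢)` — here Thm. 3.7 (iii) at `𝒢_ℍ` comes from abc-iut-w6-d062's
`compactInVerticialAt_iff_exists_verticial_of_isLocallyFinite` (uniqueness/edge conjunct
`compactInTwoVerticial_of_isLocallyFinite`). [cite: Mochizuki2012, IUTchI Prop 2.2 p.45] -/
theorem decompSubgroupsCommensurablyTerminal_of_isLocallyFinite (h37 : 𝒢.Thm37Hypotheses)
    (h37H : (𝒢.restrict H).Thm37Hypotheses) (hlf : (𝒢.restrict H).graph.IsLocallyFinite)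
    (hex : ∀ (c' : TemperedPiChart (𝒢.restrict H)) (C : Subgroup c'.G), IsCompact (C : Set c'.G) →
      ∃ (v : (𝒢.restrict H).graph.Vertex) (K : Subgroup c'.G), K ∈ verticialSubgroups c' v ∧ C ≤ K) :
    c.DecompSubgroupsCommensurablyTerminal H :=
  decompSubgroupsCommensurablyTerminal h37 h37H
    (((𝒢.restrict H).compactInVerticialAt_iff_exists_verticial_of_isLocallyFinite hlf).mpr fun _ => hex)

/-- The commensurator form at a locally finite `𝔾_ℍ` (tree predicate): `C_{π₁^temp(𝒢)}(D) = D` for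
every `D ∈ decompSubgroups c ℍ` (co-author abc-iut-w6-d071). [cite: Mochizuki2012, IUTchI Prop 2.2 p.45] -/
theorem commensurator_eq_of_mem_decompSubgroups_of_isLocallyFinite (h37 : 𝒢.Thm37Hypotheses)
    (h37H : (𝒢.restrict H).Thm37Hypotheses) (hlf : (𝒢.restrict H).graph.IsLocallyFinite)
    (hex : ∀ (c' : TemperedPiChart (𝒢.restrict H)) (C : Subgroup c'.G), IsCompact (C : Set c'.G) →
      ∃ (v : (𝒢.restrict H).graph.Vertex) (K : Subgroup c'.G), K ∈ verticialSubgroups c' v ∧ C ≤ K)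
    {D : Subgroup c.G} (hD : D ∈ c.decompSubgroups H) :
    Subgroup.Commensurable.commensurator D = D :=
  (decompSubgroupsCommensurablyTerminal_of_isLocallyFinite h37 h37H hlf hex D hD).commensurator_eq

/-- **… locally finite `ℍ` CONNECTED with a vertex, `𝒢_ℍ`-side bundle derived** (co-author
abc-iut-w6-d071): binders = the Thm. 3.7 bundle of `𝒢`, local finiteness of `𝔾_ℍ`, the existence
sentence at `𝒢_ℍ`. [cite: Mochizuki2012, IUTchI Prop 2.2 p.45] -/
theorem decompSubgroupsCommensurablyTerminal_of_isLocallyFinite_of_isConnected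
    (h37 : 𝒢.Thm37Hypotheses) (hconn : (𝒢.restrict H).IsConnected) (hv : (𝒢.restrict H).HasVertex)
    (hlf : (𝒢.restrict H).graph.IsLocallyFinite)
    (hex : ∀ (c' : TemperedPiChart (𝒢.restrict H)) (C : Subgroup c'.G), IsCompact (C : Set c'.G) →
      ∃ (v : (𝒢.restrict H).graph.Vertex) (K : Subgroup c'.G), K ∈ verticialSubgroups c' v ∧ C ≤ K) :
    c.DecompSubgroupsCommensurablyTerminal H :=
  decompSubgroupsCommensurablyTerminal_of_isLocallyFinite h37 (h37.restrictSub H hconn hv) hlf hex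

end TemperedPiChart

end ProfiniteSemiGraph

end Literature.AnabelianGeometry.SemiGraphs
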